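import Mathlib.Analysis.CStarAlgebra.Matrix
import Mathlib.Analysis.Normed.Algebra.MatrixExponential
import Mathlib.Analysis.SpecialFunctions.Exponential
import Mathlib.Analysis.Calculus.Deriv.Mul
import Mathlib.Analysis.Calculus.Deriv.Comp
import Mathlib.MeasureTheory.Integral.IntervalIntegral.FundThmCalculus
import Literature.MathematicalPhysics.QuantumLattice.LocalDynamics
import HarnessLib

/-!
# The Lieb–Robinson integral inequality (Nachtergaele–Sims) for finite quantum systems

First analytic layer of the Lieb–Robinson bound (and of the Michalakis–Zwolak stability proof,
hubbard.S19, which uses Lieb–Robinson bounds throughout §5): for a Hermitian Hamiltonian `H`, an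
observable `A` and a Hermitian `H'` commuting with `A` (think `H' = Σ_{Z ∩ X = ∅} Φ Z`, the terms
not touching the support `X` of `A`), the commutator of the Heisenberg-evolved `A` with any `B`
obeys

`‖[τ_t^H(A), B]‖ ≤ ‖[A, B]‖ + 2‖A‖ |∫₀ᵗ ‖[τ_s^H(H − H'), B]‖ ds|`

(`norm_comm_heisenbergEvolution_le`). This is the inequality from which the Lieb–Robinson bound
follows by iteration: Nachtergaele–Ogata–Sims, J. Stat. Phys. **124** (2006) 1 =
arXiv:math-ph/0603064, proof of Theorem 2.1, the display
"`‖[τ_t^{Λ₁}(A), B]‖ ≤ ‖[A,B]‖ + 2‖A‖ ∫₀^{|t|} ‖[τ_s^{Λ₁}(H_X), B]‖ ds`" (p. 4 of the arXiv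
text, obtained there from the differential equation for `f(t) = [τ_t(A), B]`, whose first term
"is norm-preserving", and their Lemma 4.1); the original iteration scheme is Nachtergaele–Sims,
CMP **265** (2006) 119 = arXiv:math-ph/0506030, §3.1. The
proof here is the interaction-picture argument: with `K = iH`, `K' = iH'`,
`U(t) = e^{tK} e^{−tK'}` one has `τ_t(A) = U A U⁻¹` (because `e^{tK'} A e^{−tK'} = A`), hence
`‖[τ_t(A), B]‖ = ‖[A, G(t)]‖` with `G(t) = U⁻¹ B U = e^{tK'} τ_{−t}(B) e^{−tK'}`, and
`G'(t) = −e^{tK'} [K − K', τ_{−t}(B)] e^{−tK'}` has norm `‖[H − H', τ_{−t}(B)]‖ =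
‖[τ_t(H − H'), B]‖`; the fundamental theorem of calculus gives the claim. No time-dependent
propagators ("norm-preserving evolutions", NS06 eq. (2.15)) are needed in this formulation.

All operator norms are the L²-operator norms (`Matrix.Norms.L2Operator`), as in
`LocalDynamics.lean`. No definitions, no named facts (theorems only).
-/

noncomputable section

open Matrix Complex NormedSpace MeasureTheory intervalIntegral
open scoped Matrix.Norms.L2Operator

namespace Literature.MathematicalPhysics.QuantumLattice

variable {n : Type*} [Fintype n] [DecidableEq n]

/-! ### The propagator `e^{tK}`, `K = iH` -/

/-- Rewriting the propagator of `heisenbergEvolution` with a real parameter: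
`e^{(it)H} = e^{t (iH)}`. [folklore] -/
theorem exp_I_mul_smul (H : Matrix n n ℂ) (t : ℝ) :
    exp ((I * t) • H) = exp (t • (I • H)) := by
  rw [← Complex.coe_smul, smul_smul, mul_comm]

/-- `e^{-(it)H} = e^{t (−iH)}`. [folklore] -/
theorem exp_neg_I_mul_smul (H : Matrix n n ℂ) (t : ℝ) :
    exp ((-(I * t)) • H) = exp (t • (-(I • H))) := by
  rw [smul_neg, ← Complex.coe_smul, smul_smul, ← neg_smul, mul_comm]

/-- The Heisenberg evolution through the real-parameter propagators:
`τ_t(A) = e^{tK} A e^{t(−K)}`, `K = iH`. [folklore] -/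
theorem heisenbergEvolution_eq_exp_smul (H : Matrix n n ℂ) (t : ℝ) (A : Matrix n n ℂ) :
    heisenbergEvolution H t A = exp (t • (I • H)) * A * exp (t • (-(I • H))) := by
  rw [heisenbergEvolution, exp_I_mul_smul, exp_neg_I_mul_smul]

/-- `e^{tK} e^{t(−K)} = 1`. [folklore] -/
theorem exp_smul_mul_exp_smul_neg (K : Matrix n n ℂ) (t : ℝ) :
    exp (t • K) * exp (t • (-K)) = 1 := by
  rw [smul_neg, ← neg_smul, ← Complex.coe_smul, ← Complex.coe_smul, Complex.ofReal_neg]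
  exact exp_smul_mul_exp_neg_smul K (t : ℂ)

/-- `e^{t(−K)} e^{tK} = 1`. [folklore] -/
theorem exp_smul_neg_mul_exp_smul (K : Matrix n n ℂ) (t : ℝ) :
    exp (t • (-K)) * exp (t • K) = 1 := by
  have h := exp_smul_mul_exp_smul_neg (-K) t
  rwa [neg_neg] at h

/-- For Hermitian `H`, `e^{t(iH)}` is unitary. [folklore] -/
theorem exp_smul_I_smul_mem_unitary {H : Matrix n n ℂ} (hH : H.IsHermitian) (t : ℝ) :
    exp (t • (I • H)) ∈ unitary (Matrix n n ℂ) := by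
  rw [← exp_I_mul_smul]
  exact exp_smul_mem_unitary hH (by simp)

/-- For Hermitian `H`, `e^{t(−iH)}` is unitary. [folklore] -/
theorem exp_smul_neg_I_smul_mem_unitary {H : Matrix n n ℂ} (hH : H.IsHermitian) (t : ℝ) :
    exp (t • (-(I • H))) ∈ unitary (Matrix n n ℂ) := by
  rw [← exp_neg_I_mul_smul]
  exact exp_smul_mem_unitary hH (by simp)

/-- Derivative of the propagator: `d/dt e^{tK} = K e^{tK}`. [folklore] -/
theorem hasDerivAt_exp_smul_left (K : Matrix n n ℂ) (t : ℝ) :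
    HasDerivAt (fun u : ℝ => exp (u • K)) (K * exp (t • K)) t :=
  hasDerivAt_exp_smul_const' K t

/-- Derivative of the propagator: `d/dt e^{tK} = e^{tK} K`. [folklore] -/
theorem hasDerivAt_exp_smul_right (K : Matrix n n ℂ) (t : ℝ) :
    HasDerivAt (fun u : ℝ => exp (u • K)) (exp (t • K) * K) t :=
  hasDerivAt_exp_smul_const K t

/-- An observable commuting with `H'` is fixed by the evolution generated by `H'`:
`e^{tK'} A e^{t(−K')} = A`, `K' = iH'`. [folklore] -/
theorem exp_smul_mul_mul_exp_smul_neg_of_commute {H' A : Matrix n n ℂ} (hc : Commute H' A)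
    (t : ℝ) : exp (t • (I • H')) * A * exp (t • (-(I • H'))) = A := by
  have hc' : Commute (t • (I • H')) A := (hc.smul_left I).smul_left t
  rw [hc'.exp_left.eq, mul_assoc, exp_smul_mul_exp_smul_neg, mul_one]

/-! ### The interaction picture and the integral inequality -/

/-- **Interaction-picture identity.** If `H'` commutes with `A` then, with `K = iH`, `K' = iH'`,
`U = e^{tK} e^{t(−K')}`, `U⁻¹ = e^{tK'} e^{t(−K)}`:
`[τ_t^H(A), B] = U [A, U⁻¹ B U] U⁻¹`. [folklore] -/
theorem comm_heisenbergEvolution_eq_conj {H H' A : Matrix n n ℂ} (hc : Commute H' A) (t : ℝ)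
    (B : Matrix n n ℂ) :
    heisenbergEvolution H t A * B - B * heisenbergEvolution H t A =
      (exp (t • (I • H)) * exp (t • (-(I • H')))) *
        (A * (exp (t • (I • H')) * exp (t • (-(I • H))) * B *
              (exp (t • (I • H)) * exp (t • (-(I • H'))))) -
          (exp (t • (I • H')) * exp (t • (-(I • H))) * B *
              (exp (t • (I • H)) * exp (t • (-(I • H'))))) * A) *
        (exp (t • (I • H')) * exp (t • (-(I • H)))) := by
  set E := exp (t • (I • H)) with hE
  set Em := exp (t • (-(I • H))) with hEm
  set F := exp (t • (I • H')) with hF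
  set Fm := exp (t • (-(I • H'))) with hFm
  have hEE : E * Em = 1 := exp_smul_mul_exp_smul_neg _ t
  have hEE' : Em * E = 1 := exp_smul_neg_mul_exp_smul _ t
  have hFF : F * Fm = 1 := exp_smul_mul_exp_smul_neg _ t
  have hFF' : Fm * F = 1 := exp_smul_neg_mul_exp_smul _ t
  have hA : F * A * Fm = A := exp_smul_mul_mul_exp_smul_neg_of_commute hc t
  -- `Fm A F = A` as well, and `τ_t(A) = E A Em = (E Fm) A (F Em)`
  have hA' : Fm * A * F = A := by
    calc Fm * A * F = Fm * (F * A * Fm) * F := by rw [hA]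
      _ = (Fm * F) * A * (Fm * F) := by simp only [mul_assoc]
      _ = A := by rw [hFF', one_mul, mul_one]
  have hτ : heisenbergEvolution H t A = E * Fm * A * (F * Em) := by
    rw [heisenbergEvolution_eq_exp_smul, ← hE, ← hEm]
    calc E * A * Em = E * (Fm * A * F) * Em := by rw [hA']
      _ = E * Fm * A * (F * Em) := by simp only [mul_assoc]
  rw [hτ]
  -- expand the right-hand side and cancel `(F Em)(E Fm) = 1`
  have hcancel : F * Em * (E * Fm) = 1 := by
    calc F * Em * (E * Fm) = F * (Em * E) * Fm := by simp only [mul_assoc]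
      _ = 1 := by rw [hEE', mul_one, hFF]
  have hcancel' : E * Fm * (F * Em) = 1 := by
    calc E * Fm * (F * Em) = E * (Fm * F) * Em := by simp only [mul_assoc]
      _ = 1 := by rw [hFF', mul_one, hEE]
  rw [Matrix.mul_sub, Matrix.sub_mul]
  congr 1
  · calc E * Fm * A * (F * Em) * B = E * Fm * A * (F * Em) * B * 1 := by rw [mul_one]
      _ = E * Fm * A * (F * Em) * B * (E * Fm * (F * Em)) := by rw [hcancel']
      _ = _ := by simp only [mul_assoc]
  · calc B * (E * Fm * A * (F * Em)) = 1 * B * (E * Fm * A * (F * Em)) := by rw [one_mul]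
      _ = (E * Fm * (F * Em)) * B * (E * Fm * A * (F * Em)) := by rw [hcancel']
      _ = _ := by simp only [mul_assoc]

/-- Norm invariance under unitary conjugation: `‖U X V‖ = ‖X‖` for unitaries `U`, `V`
(the L²-operator norm is a C⋆-norm). [folklore] -/
theorem norm_unitary_mul_mul_unitary {U V : Matrix n n ℂ} (hU : U ∈ unitary (Matrix n n ℂ))
    (hV : V ∈ unitary (Matrix n n ℂ)) (X : Matrix n n ℂ) : ‖U * X * V‖ = ‖X‖ := by
  rw [CStarRing.norm_mul_mem_unitary _ hV, CStarRing.norm_mem_unitary_mul _ hU]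

/-- **Derivative of the Heisenberg evolution**: `d/dt τ_t(B) = e^{tK} [K, B] e^{t(−K)}`,
`K = iH` (i.e. `i τ_t([H, B])`). Bratteli–Robinson II §6.2.1. [folklore] -/
theorem hasDerivAt_heisenbergEvolution (H B : Matrix n n ℂ) (t : ℝ) :
    HasDerivAt (fun u : ℝ => heisenbergEvolution H u B)
      (exp (t • (I • H)) * ((I • H) * B - B * (I • H)) * exp (t • (-(I • H)))) t := by
  have hfun : (fun u : ℝ => heisenbergEvolution H u B) =
      fun u : ℝ => exp (u • (I • H)) * B * exp (u • (-(I • H))) :=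
    funext fun u => heisenbergEvolution_eq_exp_smul H u B
  rw [hfun]
  have h1 := hasDerivAt_exp_smul_right (I • H) t
  have h2 := hasDerivAt_exp_smul_left (-(I • H)) t
  refine ((h1.mul_const B).mul h2).congr_deriv ?_
  simp only [Matrix.mul_sub, Matrix.sub_mul, Matrix.mul_neg, Matrix.neg_mul, Matrix.mul_assoc]
  abel

/-- Derivative of the time-reversed evolution `t ↦ τ_{−t}(B)`:
`−e^{(−t)K} [K, B] e^{(−t)(−K)}`. [folklore] -/
theorem hasDerivAt_heisenbergEvolution_neg (H B : Matrix n n ℂ) (t : ℝ) :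
    HasDerivAt (fun u : ℝ => heisenbergEvolution H (-u) B)
      (-(exp ((-t) • (I • H)) * ((I • H) * B - B * (I • H)) * exp ((-t) • (-(I • H))))) t := by
  have h := (hasDerivAt_heisenbergEvolution H B (-t)).scomp t (hasDerivAt_neg t)
  simpa [Function.comp_def] using h

/-- The interaction-picture observable `G(t) = e^{tK'} τ_{−t}^H(B) e^{t(−K')}` and its
derivative `G'(t) = −e^{tK'} [K − K', τ_{−t}^H(B)] e^{t(−K')}` (`K = iH`, `K' = iH'`).
Nachtergaele–Ogata–Sims (2006), proof of Thm 2.1 (the function `f(t) = [τ_t(A), B]`, here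
conjugated into the interaction picture). [folklore] -/
theorem hasDerivAt_interactionPicture (H H' B : Matrix n n ℂ) (t : ℝ) :
    HasDerivAt (fun u : ℝ => exp (u • (I • H')) * heisenbergEvolution H (-u) B *
        exp (u • (-(I • H'))))
      (-(exp (t • (I • H')) *
          ((I • H - I • H') * heisenbergEvolution H (-t) B -
            heisenbergEvolution H (-t) B * (I • H - I • H')) *
          exp (t • (-(I • H'))))) t := by
  have h1 := hasDerivAt_exp_smul_right (I • H') t
  have h2 := hasDerivAt_heisenbergEvolution_neg H B t
  have h3 := hasDerivAt_exp_smul_left (-(I • H')) t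
  refine ((h1.fun_mul h2).fun_mul h3).congr_deriv ?_
  -- normalise: `τ_{-t}(B) = e^{(-t)K} B e^{(-t)(-K)}` and `e^{(-t)K}` commutes with `K`
  set N := heisenbergEvolution H (-t) B with hN
  have hNexp : N = exp ((-t) • (I • H)) * B * exp ((-t) • (-(I • H))) :=
    heisenbergEvolution_eq_exp_smul H (-t) B
  have hc1 : exp ((-t) • (I • H)) * (I • H) = (I • H) * exp ((-t) • (I • H)) :=
    (((Commute.refl (I • H)).smul_left (-t)).exp_left).eq
  have hc2 : exp ((-t) • (-(I • H))) * (I • H) = (I • H) * exp ((-t) • (-(I • H))) := by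
    have : Commute ((-t) • (-(I • H))) (I • H) := ((Commute.refl (I • H)).neg_left).smul_left (-t)
    exact this.exp_left.eq
  have hderivN : exp ((-t) • (I • H)) * ((I • H) * B - B * (I • H)) * exp ((-t) • (-(I • H))) =
      (I • H) * N - N * (I • H) := by
    rw [hNexp, Matrix.mul_sub, Matrix.sub_mul, ← Matrix.mul_assoc, hc1]
    simp only [Matrix.mul_assoc, hc2]
  rw [hderivN]
  simp only [Matrix.mul_sub, Matrix.sub_mul, Matrix.add_mul, Matrix.mul_neg,
    Matrix.neg_mul, Matrix.mul_assoc]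
  abel

/-- The derivative of the interaction-picture observable is continuous. [folklore] -/
theorem continuous_interactionPicture_deriv (H H' B : Matrix n n ℂ) :
    Continuous fun t : ℝ => -(exp (t • (I • H')) *
        ((I • H - I • H') * heisenbergEvolution H (-t) B -
          heisenbergEvolution H (-t) B * (I • H - I • H')) *
        exp (t • (-(I • H')))) := by
  letI : NormedAlgebra ℚ (Matrix n n ℂ) := .restrictScalars ℚ ℂ _
  have hN : (fun t : ℝ => heisenbergEvolution H (-t) B) =
      fun t : ℝ => exp ((-t) • (I • H)) * B * exp ((-t) • (-(I • H))) :=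
    funext fun t => heisenbergEvolution_eq_exp_smul H (-t) B
  have hNc : Continuous fun t : ℝ => heisenbergEvolution H (-t) B := by
    rw [hN]
    fun_prop
  fun_prop

/-- The norm of the derivative of the interaction-picture observable is the commutator norm
`‖[τ_t^H(H − H'), B]‖` (unitary invariance and `τ_{−t}(τ_t(X)) = X`), for Hermitian `H`, `H'`.
[folklore] -/
theorem norm_interactionPicture_deriv {H H' : Matrix n n ℂ} (hH : H.IsHermitian)
    (hH' : H'.IsHermitian) (B : Matrix n n ℂ) (t : ℝ) :
    ‖-(exp (t • (I • H')) *
        ((I • H - I • H') * heisenbergEvolution H (-t) B -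
          heisenbergEvolution H (-t) B * (I • H - I • H')) *
        exp (t • (-(I • H'))))‖ =
      ‖heisenbergEvolution H t (H - H') * B - B * heisenbergEvolution H t (H - H')‖ := by
  rw [norm_neg, norm_unitary_mul_mul_unitary (exp_smul_I_smul_mem_unitary hH' t)
    (exp_smul_neg_I_smul_mem_unitary hH' t)]
  -- pull out the scalar `I`
  have hI : (I • H - I • H') * heisenbergEvolution H (-t) B -
      heisenbergEvolution H (-t) B * (I • H - I • H') =
        I • ((H - H') * heisenbergEvolution H (-t) B - heisenbergEvolution H (-t) B * (H - H')) := by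
    rw [← smul_sub, Matrix.smul_mul, Matrix.mul_smul, smul_sub]
  rw [hI, norm_smul, Complex.norm_I, one_mul]
  -- `[H - H', τ_{-t} B] = τ_{-t} [τ_t (H - H'), B]`
  have hev : (H - H') * heisenbergEvolution H (-t) B - heisenbergEvolution H (-t) B * (H - H') =
      heisenbergEvolution H (-t)
        (heisenbergEvolution H t (H - H') * B - B * heisenbergEvolution H t (H - H')) := by
    have h1 : heisenbergEvolution H (-t) (heisenbergEvolution H t (H - H')) = H - H' := by
      rw [← heisenbergEvolution_add, neg_add_cancel, heisenbergEvolution_zero]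
    have hsub : ∀ X Y : Matrix n n ℂ, heisenbergEvolution H (-t) (X - Y) =
        heisenbergEvolution H (-t) X - heisenbergEvolution H (-t) Y := fun X Y => by
      simp only [heisenbergEvolution, Matrix.mul_sub, Matrix.sub_mul]
    rw [hsub, heisenbergEvolution_mul, heisenbergEvolution_mul, h1]
  rw [hev, norm_heisenbergEvolution_holds hH]

/-- **The Lieb–Robinson integral inequality (Nachtergaele–Sims).** Let `H`, `H'` be Hermitian
with `H'` commuting with `A`. Then for every `B` and every time `t`,
`‖[τ_t^H(A), B]‖ ≤ ‖[A, B]‖ + 2‖A‖ |∫₀ᵗ ‖[τ_s^H(H − H'), B]‖ ds|`.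
In the application `H = Σ_Z Φ Z`, `A ∈ 𝔄_X` and `H' = Σ_{Z ∩ X = ∅} Φ Z`, so that
`H − H' = H_X = Σ_{Z ∩ X ≠ ∅} Φ Z` and the integrand is `≤ Σ_{Z ∩ X ≠ ∅} ‖[τ_s(Φ Z), B]‖`.
This is the display "`‖[τ_t^{Λ₁}(A), B]‖ ≤ ‖[A,B]‖ + 2‖A‖ ∫₀^{|t|} ‖[τ_s^{Λ₁}(H_X), B]‖ ds`"
in the proof of Theorem 2.1 of Nachtergaele–Ogata–Sims, J. Stat. Phys. **124** (2006) 1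
(arXiv:math-ph/0603064 p. 4), from which they derive
"`C_B(X,t) ≤ C_B(X,0) + 2 Σ_{Z ∩ X ≠ ∅} ‖Φ(Z)‖ ∫₀^{|t|} C_B(Z,s) ds`"; here with the signed
integral `|∫₀ᵗ|`, which equals `∫₀^{|t|}` after `s ↦ −s` for `t < 0`.
[cite: NachtergaeleOgataSimsJSP2006, proof of Thm 2.1 (arXiv:math-ph/0603064 p. 4)] -/
theorem norm_comm_heisenbergEvolution_le {H H' A : Matrix n n ℂ} (hH : H.IsHermitian)
    (hH' : H'.IsHermitian) (hc : Commute H' A) (B : Matrix n n ℂ) (t : ℝ) :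
    ‖heisenbergEvolution H t A * B - B * heisenbergEvolution H t A‖ ≤
      ‖A * B - B * A‖ + 2 * ‖A‖ *
        |∫ s in (0 : ℝ)..t,
          ‖heisenbergEvolution H s (H - H') * B - B * heisenbergEvolution H s (H - H')‖| := by
  -- the interaction-picture observable and its derivative
  set G : ℝ → Matrix n n ℂ := fun u => exp (u • (I • H')) * heisenbergEvolution H (-u) B *
    exp (u • (-(I • H'))) with hG
  set G' : ℝ → Matrix n n ℂ := fun u => -(exp (u • (I • H')) *
    ((I • H - I • H') * heisenbergEvolution H (-u) B -
      heisenbergEvolution H (-u) B * (I • H - I • H')) * exp (u • (-(I • H')))) with hG'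
  have hderiv : ∀ u, HasDerivAt G (G' u) u := fun u => hasDerivAt_interactionPicture H H' B u
  have hcont : Continuous G' := continuous_interactionPicture_deriv H H' B
  have hFTC : ∫ u in (0 : ℝ)..t, G' u = G t - G 0 :=
    integral_eq_sub_of_hasDerivAt (fun u _ => hderiv u) (hcont.intervalIntegrable 0 t)
  have hG0 : G 0 = B := by
    simp [hG]
  -- `G t` is `U⁻¹ B U`
  have hGt : G t = exp (t • (I • H')) * exp (t • (-(I • H))) * B *
      (exp (t • (I • H)) * exp (t • (-(I • H')))) := by
    simp only [hG, heisenbergEvolution_eq_exp_smul, neg_smul, smul_neg, neg_neg, Matrix.mul_assoc]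
  -- Step 1: `‖[τ_t A, B]‖ = ‖[A, G t]‖`
  have hU : exp (t • (I • H)) * exp (t • (-(I • H'))) ∈ unitary (Matrix n n ℂ) :=
    mul_mem (exp_smul_I_smul_mem_unitary hH t) (exp_smul_neg_I_smul_mem_unitary hH' t)
  have hV : exp (t • (I • H')) * exp (t • (-(I • H))) ∈ unitary (Matrix n n ℂ) :=
    mul_mem (exp_smul_I_smul_mem_unitary hH' t) (exp_smul_neg_I_smul_mem_unitary hH t)
  have hstep1 : ‖heisenbergEvolution H t A * B - B * heisenbergEvolution H t A‖ =
      ‖A * G t - G t * A‖ := by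
    rw [comm_heisenbergEvolution_eq_conj hc t B, norm_unitary_mul_mul_unitary hU hV, hGt]
  -- Step 2: `‖[A, G t]‖ ≤ ‖[A, B]‖ + 2‖A‖ ‖G t - G 0‖`
  have hstep2 : ‖A * G t - G t * A‖ ≤ ‖A * B - B * A‖ + 2 * ‖A‖ * ‖G t - G 0‖ := by
    have hsplit : A * G t - G t * A = (A * B - B * A) + (A * (G t - G 0) - (G t - G 0) * A) := by
      rw [hG0]; noncomm_ring
    rw [hsplit]
    refine (norm_add_le _ _).trans (add_le_add le_rfl ?_)
    calc ‖A * (G t - G 0) - (G t - G 0) * A‖ ≤ ‖A * (G t - G 0)‖ + ‖(G t - G 0) * A‖ :=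
          norm_sub_le _ _
      _ ≤ ‖A‖ * ‖G t - G 0‖ + ‖G t - G 0‖ * ‖A‖ :=
          add_le_add (l2_opNorm_mul _ _) (l2_opNorm_mul _ _)
      _ = 2 * ‖A‖ * ‖G t - G 0‖ := by ring
  -- Step 3: `‖G t - G 0‖ ≤ |∫ ‖G'‖|` and `‖G' s‖` is the commutator norm
  have hstep3 : ‖G t - G 0‖ ≤ |∫ s in (0 : ℝ)..t,
      ‖heisenbergEvolution H s (H - H') * B - B * heisenbergEvolution H s (H - H')‖| := by
    rw [← hFTC]
    refine (norm_integral_le_abs_integral_norm).trans (le_of_eq ?_)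
    congr 1
    refine integral_congr fun s _ => ?_
    exact norm_interactionPicture_deriv hH hH' B s
  rw [hstep1]
  refine hstep2.trans (add_le_add le_rfl ?_)
  exact mul_le_mul_of_nonneg_left hstep3 (by positivity)

end Literature.MathematicalPhysics.QuantumLattice
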